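import Literature.NumberTheory.EllipticCurves.BurungaleCastellaSkinner2025.OrdinaryGreenbergEquivalence
import Literature.NumberTheory.EllipticCurves.BurungaleCastellaSkinner2025.ProductDivisibilities
import Literature.NumberTheory.EllipticCurves.BurungaleCastellaSkinner2025.GreenbergMuInvariantGoodReduction
import HarnessLib

/-!
# Burungale–Castella–Skinner 2025 (IMRN rnaf082 = arXiv:2405.00270v2), Thm. 4.1.3 and Cor. 4.1.4 —
# GUARDED re-vendorings (period binders `Ω ≠ 0`, `δ² = ±D_K`) of the two `∀`-over-frames facts
# `thm413_…` (`OrdinaryGreenbergEquivalence.lean`) and `cor414_…` (`ProductDivisibilities.lean`),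
# with the located defect PROVED

Typing layer (role `literature-prover`, cell `b2b-bsdres` literature seat GEN 155; REFEREE 2 nit n196,
escalated g191, disposition g193: "re-type the named facts with the `Ω ≠ 0` (and period-normalisation)
guard as the BCS file did, in the same ADD-A-BINDER shape"; precedent = the v2 of
`GreenbergMuInvariantGoodReduction.lean` (same directory), whose module docstring §v2 names the two
facts repaired here). Nothing in `OrdinaryGreenbergEquivalence.lean` / `ProductDivisibilities.lean` is
edited: the two `∀`-facts keep their statements and names; this file adds their guarded twins, the
implications "unguarded ⟹ guarded", and kernel proofs of what the unguarded statements yield at the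
degenerate frame. Sibling: `YanZhu2026/GreenbergMainTheoremsAnyRootGuarded.lean` (the Yan–Zhu Prop.
3.14 / Thm. 4.7 twins, same day).

Source: A. Burungale, F. Castella, C. Skinner, *Base change and Iwasawa main conjectures for GL₂*,
IMRN 2025 rnaf082 = arXiv:2405.00270v2 (held text `paper:arxiv-2405.00270`, bib key
`BurungaleCastellaSkinner2025`); the printed statements are quoted verbatim in the module docstrings
of `OrdinaryGreenbergEquivalence.lean` (Thm. 4.1.3, p. 8, with the §4 standing line p. 7 L52–L60) and
`ProductDivisibilities.lean` (Cor. 4.1.4, p. 8) and are not re-quoted here. The objects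
`L_p^Gr(g/K) ∈ Λ_K^ur` of §4.1 are constructed in [CGS23, §1.4] against Katz's two-variable measure
`𝓛_𝔭(K)` with its CM period pair `(Ω_K, Ω_p)`, `Ω_K ∈ ℂˣ` (de Shalit II.4.12/II.4.14; Yan–Zhu Thm. 3.10:
"`Ω_p` and `Ω_K` are the CM periods associated with `K`", `Ω_K` in the denominator).

## The located defect (same mechanism as Prop. 4.2.2 v1 in this directory; kernel-checked below, §Z)

Both facts quantify `∀ (Ω δ : ℂ) (Ωp) (LK G …), IsKatzMeasure₂ … Ω δ Ωp LK → IsGreenbergLFunctionAnyRoot₂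
… LK G → …` with NO `Ω ≠ 0`. With `Ω = 0` the zero series is a Katz frame and, over it, the zero series
a Greenberg frame (`isKatzMeasure₂_zero_of_period_eq_zero`, `isGreenbergLFunctionAnyRoot₂_zero_zero`,
PROVED in `GreenbergMuInvariantGoodReduction.lean` §Z), so the facts also speak about
`(Ω, LK, G) = (0, 0, 0)` (and `G′ = 0`), where the Greenberg sides of their "reverse" equivalences,
`∃ n, (J s)ⁿ·(G) ⊆ …`, are trivially true. PROVED here (§Z), from the unguarded facts and nothing else:

* `thm413_ord_torsion_dvd_iff_greenberg_torsion_dvd.ord_of_greenberg_torsion_of_unguarded`: under the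
  Thm. 4.1.3 hypotheses, for EVERY type-I frame `F`: `X_Gr(E/K_∞)` torsion ALONE already gives `X_ord`
  torsion AND the reverse ordinary divisibility `(L_p^PR(E/K)) ⊂ ch(X_ord(E/K_∞))` in `Λ_K` (before
  inverting `p`) — print's (ii) ⟹ (i) transfer needs the Greenberg DIVISIBILITY, not just torsion; the
  divisibility so obtained is statement 4.1.1's "⊇" half, which print does not assert.
* `cor414_product_ord_localised_iff_greenberg_localised.spanLeIdealAway_of_unguarded`: under the Cor.
  4.1.4 hypotheses, for EVERY pair of type-I frames `(F, F′)` and EVERY `s ≠ 0`: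
  `S⁻¹(L_p^PR·L_p^PR′) ⊂ S⁻¹ ch(X_ord)·ch(X_ord′)` — unconditionally, which print does not assert.

## The repair (this file, §F): GUARDED twins, WEAKER than the originals

* `thm413_ord_torsion_dvd_iff_greenberg_torsion_dvd_guarded` and
* `cor414_product_ord_localised_iff_greenberg_localised_guarded`

are VERBATIM the original statements with `Ω ≠ 0 → (δ ^ 2 = D_K ∨ δ ^ 2 = −D_K) →` inserted after the
frame binder `∀ (Ω δ : ℂ) (Ωp …) (LK G [G′] …),` and before the Katz frame — exactly the conjuncts every
frame-SUPPLYING `∃`-fact delivers (`YanZhu2026.thm39_def311_…AnyRoot₂`, `thm42_…AnyRoot`,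
`prop521_baseChange_product_divisibilities` in `ProductDivisibilities.lean`, BSTW `thm617_…_PRE`), so no
consumer loses anything (it feeds the `hΩ hδ` obtained with its frame). The originals imply the twins
(`….of_unguarded`, PROVED). With `Ω ≠ 0` the degenerate member is gone and the statements say what
print says about the genuine `L_p^Gr(g/K)`.

D-0026: two NEW named facts, each the guarded re-vendoring of a mis-stated one (REFEREE 2 n196 protocol,
E608 precedent); four theorems PROVED; no statement of the tree edited. The Summits-side consumers are
the provers' pen and are not touched. Honest framing: refereed statements typed as named facts with
their printed hypotheses; typed ≠ proved ≠ endorsed; nothing here bears on BSD beyond supplying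
by-name inputs.

## References
* [BurungaleCastellaSkinner2025] IMRN 2025 rnaf082 = arXiv:2405.00270v2: Thm. 4.1.3 and Cor. 4.1.4
  (§4.1, p. 8), §4 standing line (p. 7 L52–L60), Prop. 5.2.1 (pp. 9–10), Prop. 4.2.2 (p. 9; the
  precedent repair in this directory).
* [YanZhu2024MainConjNonCM] J. Algebra 693 (2026) = arXiv:2412.20078v4: Thm. 3.10 (TeX l.854–863, the
  CM periods), Def. 3.11 (l.865–871), Thm. 4.7 (l.1022–1034; the currency).
* [deShalit1987] II.4.12 (the period pair, `Ω ∈ ℂˣ`), II.4.14, II.4.16 (49)–(50) (the frame).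
* [BurungaleSkinnerTianWan2024] arXiv:2409.01350v2, §9.3.2 / Prop. 9.18 (the printed proof).
* [CastellaGrossiSkinner2025] Math. Ann. 393 (2025), §2 / Prop. 4.2.1 (normalisations).
-/

noncomputable section

open scoped Classical

open PowerSeries NumberField IsDedekindDomain Field CongruenceSubgroup
  Literature.NumberTheory.GaloisRepresentations Literature.NumberTheory.EllipticCurves
  Literature.NumberTheory.EllipticCurves.ModularForms Literature.NumberTheory.EllipticCurves.Rank1Residual
  Literature.NumberTheory.EllipticCurves.IwasawaAlgebra₂ Literature.NumberTheory.EllipticCurves.YanZhu2026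
  Literature.NumberTheory.EllipticCurves.UnrSeries₂

namespace Literature.NumberTheory.EllipticCurves.BurungaleCastellaSkinner2025

/-! ## §Z. PROVED: what the UNGUARDED facts assert at the degenerate frame `(Ω, LK, G) = (0, 0, 0)` -/

section Located

variable {p : ℕ} [Fact p.Prime]

/-- **Located defect, Thm. 4.1.3 as typed without `Ω ≠ 0` (kernel-checked).** From the unguarded fact
`thm413_ord_torsion_dvd_iff_greenberg_torsion_dvd` ALONE: under its hypotheses (`GreenbergSetting`,
(irr_K), `ι₁` compatible with `ι`), for EVERY type-I frame `F = 𝓛_p^I(f_E/K)`: if `X_Gr(E/K_∞)` is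
`Λ_K`-torsion then `X_ord(E/K_∞)` is `Λ_K`-torsion AND `(L_p^PR(E/K)) ⊂ ch(X_ord(E/K_∞))` in `Λ_K`
(`SpanLeIdealAway 1`, "before inverting `p`"). Mechanism: at the degenerate frame
`(Ω, δ, Ω_p, LK, G) = (0, 0, 1, 0, 0)` (`isKatzMeasure₂_zero_of_period_eq_zero`,
`isGreenbergLFunctionAnyRoot₂_zero_zero`) the Greenberg side of the fact's second equivalence at `s = 1`
is `X_Gr torsion ∧ ∃ n, 1ⁿ·(0) ⊆ ch(X_Gr)·𝒪_{ℂ_p}⟦T₁,T₂⟧`, true as soon as `X_Gr` is torsion; a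
structure-compatible `J` exists (`exists_structureMap_padicInt`). Print's (ii) ⟹ (i) needs the Greenberg
DIVISIBILITY; obtaining statement 4.1.1's "⊇" half from torsion alone exhibits the MIS-STATEMENT. Cite
the guarded twin `thm413_ord_torsion_dvd_iff_greenberg_torsion_dvd_guarded` (§F) instead.
[cite: BurungaleCastellaSkinner2025, Thm. 4.1.3 (§4.1, p. 8 of arXiv:2405.00270v2) with §4 standing line (p. 7 L52–L60)]
[cite: deShalit1987, II.4.12, II.4.16 (49)–(50) (Ω ∈ ℂˣ)] -/
theorem thm413_ord_torsion_dvd_iff_greenberg_torsion_dvd.ord_of_greenberg_torsion_of_unguarded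
    (h : thm413_ord_torsion_dvd_iff_greenberg_torsion_dvd)
    (ι₁ : integralClosure ℚ ℂ →+* ℂ_[p]) (ι : PadicAlgCl p ≃+* ℂ) (W : WeierstrassCurve ℚ) [W.IsElliptic]
    [W.IsGloballyMinimal] (K : Type) [Field K] [NumberField K] (v vbar : HeightOneSpectrum (𝓞 K))
    (κ₁ κ₂ : ZpExtension K p) (γ₁ γ₂ : absoluteGaloisGroup K)
    [Fact (ZpExtension.IsTopGeneratorPair κ₁ κ₂ γ₁ γ₂)] {N : ℕ} [NeZero N]
    (π : ModularParametrizationData W N) [NeZero (NumberField.discr K).natAbs]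
    (hS : GreenbergSetting ι W N K v vbar κ₁ κ₂) (hirr : (W.baseChange K).HasIrreducibleModPGaloisRep p)
    (hι : ∀ z : integralClosure ℚ ℂ, ι₁ z = ((ι.symm (z : ℂ) : PadicAlgCl p) : ℂ_[p]))
    (F : CycAntiSeries p) (hF : IsHidaRankinLFunction ι₁ W κ₁ κ₂ π.f F) (hc : IsCongruenceIntegral π.f F)
    (hGr : Module.IsTorsion (IwasawaAlgebra₂ p) ((W.baseChange K).XGr₂ p κ₁ κ₂ vbar γ₁ γ₂)) :
    Module.IsTorsion (IwasawaAlgebra₂ p) ((W.baseChange K).XOrd₂ p κ₁ κ₂ γ₁ γ₂) ∧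
      SpanLeIdealAway 1 (perrinRiouLFunction W π F)
        (WeierstrassCurve.XOrd₂.charIdeal (W.baseChange K) p κ₁ κ₂ γ₁ γ₂) := by
  obtain ⟨J, hJ⟩ := exists_structureMap_padicInt (p := p)
  have h2 := (h ι₁ ι W K v vbar κ₁ κ₂ γ₁ γ₂ π hS hirr hι F hF hc 0 0 1 0 0
    (isKatzMeasure₂_zero_of_period_eq_zero ι v vbar ∅ κ₁ κ₂ γ₁⁻¹ γ₂⁻¹ 1 0 _)
    (isGreenbergLFunctionAnyRoot₂_zero_zero ι v vbar κ₁ κ₂ γ₁⁻¹ γ₂⁻¹ π.f _ _) J hJ 1 (Or.inl rfl)).2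
  refine h2.mpr ⟨hGr, 0, ?_⟩
  rw [Ideal.span_singleton_eq_bot.mpr rfl, Ideal.mul_bot]
  exact bot_le

/-- **Located defect, Cor. 4.1.4 as typed without `Ω ≠ 0` (kernel-checked).** From the unguarded fact
`cor414_product_ord_localised_iff_greenberg_localised` ALONE: under its hypotheses (`GreenbergSetting`
for `E` and `E′`, (irr_K) for both, `ι₁` compatible with `ι`), for EVERY pair of type-I frames
`(F, F′)` and EVERY `s ≠ 0`: `S⁻¹(L_p^PR(E/K)·L_p^PR(E′/K)) ⊂ S⁻¹ ch(X_ord(E))·ch(X_ord(E′))`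
(`SpanLeIdealAway s`). Mechanism: at the degenerate frame `(Ω, LK, G, G′) = (0, 0, 0, 0)` the Greenberg
side of the fact's second equivalence is `∃ n, (J s)ⁿ·(0·0) ⊆ …`, true with `n = 0`; a
structure-compatible `J` exists (`exists_structureMap_padicInt`). Print asserts no unconditional
divisibility; obtaining one exhibits the MIS-STATEMENT. Cite the guarded twin
`cor414_product_ord_localised_iff_greenberg_localised_guarded` (§F) instead.
[cite: BurungaleCastellaSkinner2025, Cor. 4.1.4 (§4.1, p. 8 of arXiv:2405.00270v2) with Thm. 4.1.3 and §4 standing line (p. 7 L52–L60)]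
[cite: deShalit1987, II.4.12, II.4.16 (49)–(50) (Ω ∈ ℂˣ)] -/
theorem cor414_product_ord_localised_iff_greenberg_localised.spanLeIdealAway_of_unguarded
    (h : cor414_product_ord_localised_iff_greenberg_localised)
    (ι₁ : integralClosure ℚ ℂ →+* ℂ_[p]) (ι : PadicAlgCl p ≃+* ℂ)
    (W W' : WeierstrassCurve ℚ) [W.IsElliptic] [W.IsGloballyMinimal] [W'.IsElliptic]
    [W'.IsGloballyMinimal] (K : Type) [Field K] [NumberField K] (v vbar : HeightOneSpectrum (𝓞 K))
    (κ₁ κ₂ : ZpExtension K p) (γ₁ γ₂ : absoluteGaloisGroup K)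
    [Fact (ZpExtension.IsTopGeneratorPair κ₁ κ₂ γ₁ γ₂)] {N N' : ℕ} [NeZero N] [NeZero N']
    (π : ModularParametrizationData W N) (π' : ModularParametrizationData W' N')
    [NeZero (NumberField.discr K).natAbs]
    (hS : GreenbergSetting ι W N K v vbar κ₁ κ₂) (hS' : GreenbergSetting ι W' N' K v vbar κ₁ κ₂)
    (hirr : (W.baseChange K).HasIrreducibleModPGaloisRep p)
    (hirr' : (W'.baseChange K).HasIrreducibleModPGaloisRep p)
    (hι : ∀ z : integralClosure ℚ ℂ, ι₁ z = ((ι.symm (z : ℂ) : PadicAlgCl p) : ℂ_[p]))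
    (F F' : CycAntiSeries p) (hF : IsHidaRankinLFunction ι₁ W κ₁ κ₂ π.f F)
    (hc : IsCongruenceIntegral π.f F) (hF' : IsHidaRankinLFunction ι₁ W' κ₁ κ₂ π'.f F')
    (hc' : IsCongruenceIntegral π'.f F') (s : IwasawaAlgebra₂ p) (hs : s ≠ 0) :
    SpanLeIdealAway s (perrinRiouLFunction W π F * perrinRiouLFunction W' π' F')
      (WeierstrassCurve.XOrd₂.charIdeal (W.baseChange K) p κ₁ κ₂ γ₁ γ₂ *
        WeierstrassCurve.XOrd₂.charIdeal (W'.baseChange K) p κ₁ κ₂ γ₁ γ₂) := by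
  obtain ⟨J, hJ⟩ := exists_structureMap_padicInt (p := p)
  have h2 := (h ι₁ ι W W' K v vbar κ₁ κ₂ γ₁ γ₂ π π' hS hS' hirr hirr' hι F F' hF hc hF' hc' 0 0 1 0 0 0
    (isKatzMeasure₂_zero_of_period_eq_zero ι v vbar ∅ κ₁ κ₂ γ₁⁻¹ γ₂⁻¹ 1 0 _)
    (isGreenbergLFunctionAnyRoot₂_zero_zero ι v vbar κ₁ κ₂ γ₁⁻¹ γ₂⁻¹ π.f _ _)
    (isGreenbergLFunctionAnyRoot₂_zero_zero ι v vbar κ₁ κ₂ γ₁⁻¹ γ₂⁻¹ π'.f _ _) J hJ s hs).2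
  refine h2.mpr ⟨0, ?_⟩
  rw [mul_zero, Ideal.span_singleton_eq_bot.mpr rfl, Ideal.mul_bot]
  exact bot_le

end Located

/-! ## §F. The GUARDED named facts (Thm. 4.1.3, Cor. 4.1.4 — period binders `Ω ≠ 0`, `δ² = ±D_K`) -/

section Facts

/-- **Burungale–Castella–Skinner, IMRN 2025 (rnaf082) = arXiv:2405.00270v2, Theorem 4.1.3 (§4.1, p. 8) —
the ordinary statement 4.1.1 and the Greenberg statement 4.1.2 are EQUIVALENT, torsion clauses included —
GUARDED re-vendoring** of `thm413_ord_torsion_dvd_iff_greenberg_torsion_dvd`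
(`OrdinaryGreenbergEquivalence.lean`; mis-stated as a `∀`-statement over frames WITHOUT the period
binder, module docstring and §Z). Print (verbatim in that file's module docstring): for an elliptic
newform `g`, `p ∤ 2N` ordinary, `K` imaginary quadratic with (spl), `(D_K, N) = 1`, (irr_K): (i)
[`X_ord(g/K_∞)` is `Λ_K`-torsion with `(L_p^PR(g/K)) ⊃ ch(X_ord(g/K_∞))` in `Λ_K ⊗ ℚ_p`] ⟺ (ii)
[`X_Gr(g/K_∞)` is `Λ_K`-torsion with `(L_p^Gr(g/K)) ⊃ ch(X_Gr(g/K_∞))` in `Λ_K^ur ⊗ ℚ_p`]; "The same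
conclusion holds for the opposite divisibilities, and before inverting `p`." VERBATIM the original
transcription with `Ω ≠ 0 → (δ² = D_K ∨ δ² = −D_K) →` inserted before the Katz frame: for `g = f_E`,
`E = W` under `GreenbergSetting` (WEAKER: also (disc)), (irr_K), `ι₁` compatible with `ι`, for every
type-I frame `F`, every Katz frame with GENUINE period data (`Ω ≠ 0` — print's CM period `Ω_K ∈ ℂˣ`,
`δ² = ±D_K`, `Ω_p ∈ R₀ˣ`) with a Greenberg series `G` of `f_E` over it (print's `L_p^Gr(g/K)`), every
structure-compatible `J`, and `s ∈ {1, p}` ("before inverting `p`" / "in `⊗ ℚ_p`"):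
`[X_ord torsion ∧ S⁻¹ch(X_ord) ⊂ (L^PR)] ↔ [X_Gr torsion ∧ ∃ n, J(s)ⁿ·ch(X_Gr)𝒪_{ℂ_p}⟦T₁,T₂⟧ ⊆ (G)]`
AND `[X_ord torsion ∧ S⁻¹(L^PR) ⊂ S⁻¹ch(X_ord)] ↔ [X_Gr torsion ∧ ∃ n, J(s)ⁿ·(G) ⊆ ch(X_Gr)𝒪_{ℂ_p}⟦T₁,T₂⟧]`.
WEAKER than the unguarded statement (`….of_unguarded`); says what print says about the genuine
`L_p^Gr(g/K)`. Users take `(h : thm413_ord_torsion_dvd_iff_greenberg_torsion_dvd_guarded)` and feed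
`hΩ hδ` from their frame supplier.
[cite: BurungaleCastellaSkinner2025, Thm. 4.1.3 (§4.1, p. 8 of arXiv:2405.00270v2) with §4 standing (irr_K) (p. 7 L52–L60)]
[cite: BurungaleSkinnerTianWan2024, §9.3.2 / Prop. 9.18 (the printed proof: four-term Poitou–Tate sequences)]
[cite: YanZhu2024MainConjNonCM, Thm. 4.7 (arXiv:2412.20078v4 TeX l.1022–1034) (currency, (T8)) and Thm. 3.10 (l.854–863: the CM periods Ω_p, Ω_K)]
[cite: deShalit1987, II.4.12, II.4.16 (49)–(50) (Ω ∈ ℂˣ, δ = √(±d_K))] -/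
def thm413_ord_torsion_dvd_iff_greenberg_torsion_dvd_guarded : Prop :=
  ∀ {p : ℕ} [Fact p.Prime] (ι₁ : integralClosure ℚ ℂ →+* ℂ_[p]) (ι : PadicAlgCl p ≃+* ℂ)
    (W : WeierstrassCurve ℚ) [W.IsElliptic] [W.IsGloballyMinimal] (K : Type) [Field K] [NumberField K]
    (v vbar : HeightOneSpectrum (𝓞 K)) (κ₁ κ₂ : ZpExtension K p) (γ₁ γ₂ : absoluteGaloisGroup K)
    [Fact (ZpExtension.IsTopGeneratorPair κ₁ κ₂ γ₁ γ₂)] {N : ℕ} [NeZero N]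
    (π : ModularParametrizationData W N) [NeZero (NumberField.discr K).natAbs],
    GreenbergSetting ι W N K v vbar κ₁ κ₂ → (W.baseChange K).HasIrreducibleModPGaloisRep p →
    (∀ z : integralClosure ℚ ℂ, ι₁ z = ((ι.symm (z : ℂ) : PadicAlgCl p) : ℂ_[p])) →
    ∀ F : CycAntiSeries p, IsHidaRankinLFunction ι₁ W κ₁ κ₂ π.f F → IsCongruenceIntegral π.f F →
    -- every Katz frame with GENUINE period data, and every Greenberg frame over it
    ∀ (Ω δ : ℂ) (Ωp : (unrIntegers p)ˣ) (LK G : PowerSeries (PowerSeries (PadicComplexInt p))),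
      Ω ≠ 0 → (δ ^ 2 = (NumberField.discr K : ℂ) ∨ δ ^ 2 = -(NumberField.discr K : ℂ)) →
      IsKatzMeasure₂ ι v vbar ∅ κ₁ κ₂ γ₁⁻¹ γ₂⁻¹ 1 Ω δ ((Ωp : unrIntegers p) : ℂ_[p]) LK →
      IsGreenbergLFunctionAnyRoot₂ ι v vbar κ₁ κ₂ γ₁⁻¹ γ₂⁻¹ π.f (NumberField.discr K).natAbs
        (NumberField.classNumber K) LK G →
    ∀ J : ℤ_[p] →+* PadicComplexInt p,
      (∀ x : ℤ_[p], ((J x : PadicComplexInt p) : ℂ_[p]) = ((x : ℚ_[p]) : ℂ_[p])) →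
    ∀ s : IwasawaAlgebra₂ p, (s = 1 ∨ s = (p : IwasawaAlgebra₂ p)) →
      ((Module.IsTorsion (IwasawaAlgebra₂ p) ((W.baseChange K).XOrd₂ p κ₁ κ₂ γ₁ γ₂) ∧
          IdealLeSpanAway s (WeierstrassCurve.XOrd₂.charIdeal (W.baseChange K) p κ₁ κ₂ γ₁ γ₂)
            (perrinRiouLFunction W π F)) ↔
        (Module.IsTorsion (IwasawaAlgebra₂ p) ((W.baseChange K).XGr₂ p κ₁ κ₂ vbar γ₁ γ₂) ∧
          ∃ n : ℕ, Ideal.span {toUnr₂ p J s ^ n} *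
              (WeierstrassCurve.XGr₂.charIdeal (W.baseChange K) p κ₁ κ₂ vbar γ₁ γ₂).map (toUnr₂ p J) ≤
            Ideal.span {G})) ∧
      ((Module.IsTorsion (IwasawaAlgebra₂ p) ((W.baseChange K).XOrd₂ p κ₁ κ₂ γ₁ γ₂) ∧
          SpanLeIdealAway s (perrinRiouLFunction W π F)
            (WeierstrassCurve.XOrd₂.charIdeal (W.baseChange K) p κ₁ κ₂ γ₁ γ₂)) ↔
        (Module.IsTorsion (IwasawaAlgebra₂ p) ((W.baseChange K).XGr₂ p κ₁ κ₂ vbar γ₁ γ₂) ∧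
          ∃ n : ℕ, Ideal.span {toUnr₂ p J s ^ n} * Ideal.span {G} ≤
            (WeierstrassCurve.XGr₂.charIdeal (W.baseChange K) p κ₁ κ₂ vbar γ₁ γ₂).map (toUnr₂ p J)))

/-- **Burungale–Castella–Skinner, IMRN 2025 (rnaf082) = arXiv:2405.00270v2, Corollary 4.1.4 (§4.1,
p. 8) — the two-variable equivalence for PRODUCTS of two forms — GUARDED re-vendoring** of
`cor414_product_ord_localised_iff_greenberg_localised` (`ProductDivisibilities.lean`; mis-stated as a
`∀`-statement over frames WITHOUT the period binder, module docstring and §Z). Print (verbatim in that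
file's module docstring): for newforms `g, g′`, `p ∤ 2NN′` ordinary for both, `K` imaginary quadratic
with (spl), `(D_K, NN′) = 1` and (irr_K) for both: (i) `(L_p^PR(g/K)·L_p^PR(g′/K)) ⊃
ch(X_ord(g))·ch(X_ord(g′))` ⟺ (ii) `(L_p^Gr(g/K)·L_p^Gr(g′/K)) ⊃ ch(X_Gr(g))·ch(X_Gr(g′))`, "Moreover,
the same holds for the opposite divisibility." VERBATIM the original transcription with
`Ω ≠ 0 → (δ² = D_K ∨ δ² = −D_K) →` inserted before the Katz frame: for the newforms of two elliptic
curves `E = W`, `E′ = W′` under `GreenbergSetting` for both (WEAKER: also (disc)) and (irr_K) for both,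
`ι₁` compatible with `ι`, in the `S = {sⁿ}` currency of `YanZhu2026.thm47_…` for every `s ≠ 0`: for
every pair of type-I frames `(F, F′)`, every Katz frame `LK` with GENUINE period data (`Ω ≠ 0` — print's
CM period `Ω_K ∈ ℂˣ`, `δ² = ±D_K`, `Ω_p ∈ R₀ˣ`) with Greenberg series `G, G′` of `f_E, f_{E′}` over it,
and every structure-compatible `J`,
`[S⁻¹ ch·ch′ ⊂ (L^PR·L^PR′)] ↔ [∃ n, J(s)ⁿ·(ch_Gr·ch_Gr′)𝒪_{ℂ_p}⟦T₁,T₂⟧ ⊆ (G·G′)]` and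
`[S⁻¹(L^PR·L^PR′) ⊂ S⁻¹ ch·ch′] ↔ [∃ n, J(s)ⁿ·(G·G′) ⊆ (ch_Gr·ch_Gr′)𝒪_{ℂ_p}⟦T₁,T₂⟧]`.
WEAKER than the unguarded statement (`….of_unguarded`); says what print says about the genuine
`L_p^Gr(g/K), L_p^Gr(g′/K)`. Users take `(h : cor414_product_ord_localised_iff_greenberg_localised_guarded)`
and feed `hΩ hδ` from their frame supplier (`prop521_baseChange_product_divisibilities` delivers them).
[cite: BurungaleCastellaSkinner2025, Cor. 4.1.4 (§4.1, p. 8 of arXiv:2405.00270v2) with Thm. 4.1.3 and its proof (p. 8), §4 standing line (p. 7 L52–L60)]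
[cite: YanZhu2024MainConjNonCM, Thm. 4.7 (arXiv:2412.20078v4 TeX l.1022–1034) (the one-form case; currency) and Thm. 3.10 (l.854–863: the CM periods Ω_p, Ω_K)]
[cite: deShalit1987, II.4.12, II.4.16 (49)–(50) (Ω ∈ ℂˣ, δ = √(±d_K))] -/
def cor414_product_ord_localised_iff_greenberg_localised_guarded : Prop :=
  ∀ {p : ℕ} [Fact p.Prime] (ι₁ : integralClosure ℚ ℂ →+* ℂ_[p]) (ι : PadicAlgCl p ≃+* ℂ)
    (W W' : WeierstrassCurve ℚ) [W.IsElliptic] [W.IsGloballyMinimal] [W'.IsElliptic]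
    [W'.IsGloballyMinimal] (K : Type) [Field K] [NumberField K] (v vbar : HeightOneSpectrum (𝓞 K))
    (κ₁ κ₂ : ZpExtension K p) (γ₁ γ₂ : absoluteGaloisGroup K)
    [Fact (ZpExtension.IsTopGeneratorPair κ₁ κ₂ γ₁ γ₂)] {N N' : ℕ} [NeZero N] [NeZero N']
    (π : ModularParametrizationData W N) (π' : ModularParametrizationData W' N')
    [NeZero (NumberField.discr K).natAbs],
    GreenbergSetting ι W N K v vbar κ₁ κ₂ → GreenbergSetting ι W' N' K v vbar κ₁ κ₂ →
    (W.baseChange K).HasIrreducibleModPGaloisRep p → (W'.baseChange K).HasIrreducibleModPGaloisRep p →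
    (∀ z : integralClosure ℚ ℂ, ι₁ z = ((ι.symm (z : ℂ) : PadicAlgCl p) : ℂ_[p])) →
    ∀ F F' : CycAntiSeries p, IsHidaRankinLFunction ι₁ W κ₁ κ₂ π.f F → IsCongruenceIntegral π.f F →
      IsHidaRankinLFunction ι₁ W' κ₁ κ₂ π'.f F' → IsCongruenceIntegral π'.f F' →
    -- every Katz frame with GENUINE period data, and every pair of Greenberg frames over it
    ∀ (Ω δ : ℂ) (Ωp : (unrIntegers p)ˣ) (LK G G' : PowerSeries (PowerSeries (PadicComplexInt p))),
      Ω ≠ 0 → (δ ^ 2 = (NumberField.discr K : ℂ) ∨ δ ^ 2 = -(NumberField.discr K : ℂ)) →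
      IsKatzMeasure₂ ι v vbar ∅ κ₁ κ₂ γ₁⁻¹ γ₂⁻¹ 1 Ω δ ((Ωp : unrIntegers p) : ℂ_[p]) LK →
      IsGreenbergLFunctionAnyRoot₂ ι v vbar κ₁ κ₂ γ₁⁻¹ γ₂⁻¹ π.f (NumberField.discr K).natAbs
        (NumberField.classNumber K) LK G →
      IsGreenbergLFunctionAnyRoot₂ ι v vbar κ₁ κ₂ γ₁⁻¹ γ₂⁻¹ π'.f (NumberField.discr K).natAbs
        (NumberField.classNumber K) LK G' →
    ∀ J : ℤ_[p] →+* PadicComplexInt p,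
      (∀ x : ℤ_[p], ((J x : PadicComplexInt p) : ℂ_[p]) = ((x : ℚ_[p]) : ℂ_[p])) →
    ∀ s : IwasawaAlgebra₂ p, s ≠ 0 →
      (IdealLeSpanAway s
          (WeierstrassCurve.XOrd₂.charIdeal (W.baseChange K) p κ₁ κ₂ γ₁ γ₂ *
            WeierstrassCurve.XOrd₂.charIdeal (W'.baseChange K) p κ₁ κ₂ γ₁ γ₂)
          (perrinRiouLFunction W π F * perrinRiouLFunction W' π' F') ↔
        ∃ n : ℕ, Ideal.span {toUnr₂ p J s ^ n} *
            ((WeierstrassCurve.XGr₂.charIdeal (W.baseChange K) p κ₁ κ₂ vbar γ₁ γ₂).map (toUnr₂ p J) *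
              (WeierstrassCurve.XGr₂.charIdeal (W'.baseChange K) p κ₁ κ₂ vbar γ₁ γ₂).map (toUnr₂ p J)) ≤
          Ideal.span {G * G'}) ∧
      (SpanLeIdealAway s (perrinRiouLFunction W π F * perrinRiouLFunction W' π' F')
          (WeierstrassCurve.XOrd₂.charIdeal (W.baseChange K) p κ₁ κ₂ γ₁ γ₂ *
            WeierstrassCurve.XOrd₂.charIdeal (W'.baseChange K) p κ₁ κ₂ γ₁ γ₂) ↔
        ∃ n : ℕ, Ideal.span {toUnr₂ p J s ^ n} * Ideal.span {G * G'} ≤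
          (WeierstrassCurve.XGr₂.charIdeal (W.baseChange K) p κ₁ κ₂ vbar γ₁ γ₂).map (toUnr₂ p J) *
            (WeierstrassCurve.XGr₂.charIdeal (W'.baseChange K) p κ₁ κ₂ vbar γ₁ γ₂).map (toUnr₂ p J))

end Facts

/-! ## §C. PROVED: the unguarded facts imply the guarded twins (switching loses nothing) -/

section API

/-- `thm413_… → thm413_…_guarded`: the guarded twin is WEAKER (two extra hypotheses, dropped). Recorded
so that nothing proved from the original (e.g. the torsion transfers of `OrdinaryGreenbergEquivalence.lean`)
is lost by switching; the converse fails (§Z).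
[cite: BurungaleCastellaSkinner2025, Thm. 4.1.3 (§4.1, p. 8 of arXiv:2405.00270v2)] -/
theorem thm413_ord_torsion_dvd_iff_greenberg_torsion_dvd_guarded.of_unguarded
    (h : thm413_ord_torsion_dvd_iff_greenberg_torsion_dvd) :
    thm413_ord_torsion_dvd_iff_greenberg_torsion_dvd_guarded :=
  fun ι₁ ι W _ _ K _ _ v vbar κ₁ κ₂ γ₁ γ₂ _ _ _ π _ hS hirr hι F hF hc Ω δ Ωp LK G _ _ hLK hG J hJ s hs ↦
    h ι₁ ι W K v vbar κ₁ κ₂ γ₁ γ₂ π hS hirr hι F hF hc Ω δ Ωp LK G hLK hG J hJ s hs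

/-- `cor414_… → cor414_…_guarded`: the guarded twin is WEAKER (two extra hypotheses, dropped). Recorded
so that nothing proved from the original (e.g. `idealLeSpan_mul_of_prop521` & co.) is lost by switching;
the converse fails (§Z). [cite: BurungaleCastellaSkinner2025, Cor. 4.1.4 (§4.1, p. 8 of arXiv:2405.00270v2)] -/
theorem cor414_product_ord_localised_iff_greenberg_localised_guarded.of_unguarded
    (h : cor414_product_ord_localised_iff_greenberg_localised) :
    cor414_product_ord_localised_iff_greenberg_localised_guarded :=
  fun ι₁ ι W W' _ _ _ _ K _ _ v vbar κ₁ κ₂ γ₁ γ₂ _ _ _ _ _ π π' _ hS hS' hirr hirr' hι F F' hF hc hF' hc'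
      Ω δ Ωp LK G G' _ _ hLK hG hG' J hJ s hs ↦
    h ι₁ ι W W' K v vbar κ₁ κ₂ γ₁ γ₂ π π' hS hS' hirr hirr' hι F F' hF hc hF' hc' Ω δ Ωp LK G G' hLK hG
      hG' J hJ s hs

end API

end Literature.NumberTheory.EllipticCurves.BurungaleCastellaSkinner2025

end
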